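import Literature.NumberTheory.GaussSums.KummerClassesEquidistributionProofs
import Literature.NumberTheory.LFunctions.EisensteinGrossencharacterLFunction
import Literature.NumberTheory.LFunctions.EisensteinGrossencharacterEuler
import HarnessLib

/-!
# Equidistribution of Kummer's classes — the Hecke half (`3 ∣ k`) of the Weyl criterion, proved

Topic `NumberTheory/GaussSums`; namespaces `Literature.NumberTheory.GaussSums` and
`Literature.NumberTheory.GaussSums.KummerClasses`; third file of the story
`KummerClassesEquidistribution.lean` (the named fact `HeathBrownPatterson1979_kummerClasses`:
each of Kummer's three classes of primes `p ≡ 1 (mod 3)` has natural density `1/3`) and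
`KummerClassesEquidistributionProofs.lean` (the elementary reductions, Ireland–Rosen Ch. 9 §12:
`S_p = 2√p cos θ_p`, the Weyl criterion split into the orders `3 ∣ k` — a statement about
`arg g_p³ = arg (p J_p)`, "Hecke" — and `3 ∤ k` — Heath-Brown–Patterson's estimate (3)).
Everything here is PROVED (theorems only, no named fact, D-0026).

**What is proved.** The hypothesis `hHecke` of
`HeathBrownPatterson1979_kummerClasses_of_hecke_of_heathBrownPatterson` is discharged:

* `KummerClasses.isLittleO_sum_cos_arg_cube` — for every `m ≠ 0` and every choice of primitive
  roots `r_p`, `Σ_{p < B, p ≡ 1 (3)} cos(m · arg g_{p,r_p}³) = o(#{p < B : p ≡ 1 (3)})`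
  (`KummerClasses.tendsto_sum_cos_arg_cube_div_card`: the normalised Weyl sums tend to `0`);
* hence **`HeathBrownPatterson1979_kummerClasses_of_heathBrownPatterson`** — the fact follows from
  the single remaining analytic input, Heath-Brown–Patterson's estimate for the orders `k` prime
  to `3`: `Σ_{p < B, p ≡ 1 (3)} cos(k · arg g_{p,r_p}) = o(#{p < B : p ≡ 1 (3)})` (`3 ∤ k`), i.e.
  the uniform distribution of `θ_p` itself [HeathBrownPatterson1979, Theorem 1; restated in
  HeathBrown2000Kummer §1, estimate (3)] — the cubic metaplectic input, not in the tree;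
* by-product `tendsto_kummerPrimeCount_succ_mul_log_div` — the prime number theorem for
  `p ≡ 1 (mod 3)` through `ℚ(ω)`: `#{p ≤ N : p ≡ 1 (3)} · log N / N → 1/2`.

**The argument (Hecke 1920, §§6–7, as assembled from the tree).** Let `K3 = ℚ(ω)`
(`NumberFields/EisensteinField*`, `e = embC : K3 → ℂ`, `ω ↦ w = e^{2πi/3}`; `w_eq_omega`
identifies it with `GaussSums.omega`) and, for `m ≥ 1`, `ν_m = grossenNu 1 0 m` the
Grössencharakter `ν_m(I) = (e(α_I)/|e(α_I)|)^m` (`α_I ≡ 1 (mod 3)` the primary generator of an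
ideal `I` prime to `3`) of `LFunctions/EisensteinGrossencharacterSums`.
(A) `L(s, ν_m)` and `L(s, ν_{2m}) = L(s, ν_m²)` are holomorphic on `Re s > 3/4`
(`EisensteinGrossen.differentiableOn_grossenL`, from the `O(N^{3/4})` partial sums — Hecke §6 by
lattice points in sectors), so the tree's `IdealCharPNT.exists_continuousOn_eq_tsum_logTerm`
(Mertens `3-4-1` on the line `Re s = 1`, Landau) continues `Σ_𝔭 ν_m(𝔭) log N𝔭 N𝔭^{-s}` to
`Re s ≥ 1`, the conjugate series being `s ↦ conj r(conj s)`; `IdealCharPNT.tendsto_sum_mul_log_div`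
(Wiener–Ikehara with the weights `1 + Re(wν)`) gives `Σ_{N𝔭 ≤ N} ν_m(𝔭) = o(N / log N)` and, from
the weights `1 ± Re ν₁`, `#{𝔭 : N𝔭 ≤ N} ∼ N / log N` (`tendsto_sum_grossenNu_mul_log_div`,
`tendsto_card_primes_mul_log_div`).
(B) Regrouping over the rational primes (`EisensteinGrossencharacterEuler`: `underPrime`,
`primesOver`, `exists_split_data`, `primesOver_of_mod_three_eq_two`, `primesOver_three`): the
primes of norm `≤ N` above `p ≡ 1 (3)`, `p ≤ N`, are `𝔭_p ≠ 𝔭̄_p` of norm `p`; above `p ≢ 1 (3)`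
there is at most one, of norm `≤ N` only if `p = 3` or `p² ≤ N` — `O(√N)` primes in all
(`sum_biUnion_eq_split_add_nonsplit`, `norm_sum_nonsplit_le`). With `ν_m(𝔭̄) = conj ν_m(𝔭)`
(`grossenNu_conjPrime`): `Σ_{p ≤ N, p ≡ 1 (3)} Re ν_m(𝔭_p) = o(N / log N)` and
`#{p ≤ N : p ≡ 1 (3)} ∼ N / (2 log N)`, so the quotient tends to `0`
(`tendsto_sum_re_grossenNu_div_card`).
(C) `re_grossenNu_eq_cos`: for `p ≡ 1 (3)` and a primitive root `r`, `J = J(χ_{p,r}, χ_{p,r}) = a + bω`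
with `a ≡ −1`, `b ≡ 0 (mod 3)` and `|J|² = p` (`KummerSector.jacobiSum_cubicMulChar_primary`,
Ireland–Rosen Prop. 8.3.4; `normSq_jacobiSum_cubicMulChar`), so `−J = e(x)`, `x = −a − bω ≡ 1 (mod 3)`
a prime of `ℤ[ω]` of norm `p`: `x` is the primary generator of `𝔭_p` or of `𝔭̄_p`, whence
`Re ν_m(𝔭_p) = Re (−J/√p)^m = (−1)^m cos(m · arg g_{p,r}³)` (`g³ = pJ`, Prop. 8.3.3;
`KummerClasses.cos_nat_mul_arg`).
(D) Assembly with the doubling/Chebyshev/Weyl reductions of `KummerClassesEquidistributionProofs`.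

## References

* E. Hecke, *Eine neue Art von Zetafunktionen und ihre Beziehungen zur Verteilung der Primzahlen*
  II, Math. Z. 6 (1920), 11–51, §§6–7. [cite: HeckeMathZ1920, §7]
* K. Ireland, M. Rosen, *A Classical Introduction to Modern Number Theory*, 2nd ed., GTM 84 (1990),
  Ch. 8 §3 Props. 8.3.3–8.3.4; Ch. 9 §1 Prop. 9.1.4, §12 Lemma 1 and the closing remarks p. 138.
  [cite: IrelandRosen1990, Ch. 9 §12]
* D. R. Heath-Brown, S. J. Patterson, *The distribution of Kummer sums at prime arguments*,
  J. reine angew. Math. 310 (1979), 111–130, Theorem 1. [cite: HeathBrownPatterson1979, Theorem 1]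
* D. R. Heath-Brown, *Kummer's conjecture for cubic Gauss sums*, Israel J. Math. 120 (2000),
  97–124, §1, estimate (3). [cite: HeathBrown2000Kummer, §1]

## Mathlib / tree search

Tree (all proved): `EisensteinGrossencharacterSums` (`grossenNu`, `norm_grossenNu_le`, `grossenNu_sq`,
`grossenNu_span_of_primary`, `embC_mkInt`, `w_re`, `w_im`, `isCoprime_three_of_sub_one_mem`, `Adm`),
`EisensteinGrossencharacterLFunction` (`grossenL`, `differentiableOn_grossenL`, `grossenL_eq_LSeries`),
`EisensteinGrossencharacterEuler` (`underPrime`, `underPrime_eq_iff`, `underPrime_prime`, `primesOver`,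
`mem_primesOver`, `primeOf`, `primesOver_of_mod_three_eq_two`, `primesOver_three`, `absNorm_span_natCast`,
`conjPrime`, `residueCard_conjPrime`, `grossenNu_conjPrime`, `exists_split_data`),
`EisensteinFieldPrimes` (`prime_mkInt_of_norm_eq_prime`, `span_natCast_eq_mul_conj`, `neg_mkInt`,
`prime_lamInt`), `EisensteinFieldIntegers` (`mkInt_add`, `mkInt_intCast`, `intCast_dvd_mkInt_iff`),
`IdealCharacterPNT` (`exists_continuousOn_eq_tsum_logTerm`, `tendsto_sum_mul_log_div`,
`tendsto_sum_one_add_re_mul_log_div`), `PrimeLogDensity.mem_primesOfNorm`, `KummerSector`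
(`omega`, `cubicGaussSum_pow_three`, `jacobiSum_cubicMulChar_primary`),
`KummerClassesEquidistributionProofs` (`cos_nat_mul_arg`, `normSq_jacobiSum_cubicMulChar`,
`normSq_int_add_int_mul_omega`, `HeathBrownPatterson1979_kummerClasses_of_hecke_of_heathBrownPatterson`).
Mathlib: `Complex.conj_tsum`, `Complex.conj_cpow`, `isLittleO_log_rpow_atTop`,
`Finset.sum_fiberwise_of_maps_to`, `Finset.sum_biUnion`, `Ideal.absNorm_dvd_absNorm_of_le`,
`Nat.dvd_prime_pow`, `Real.cos_pi_div_three`, `Real.sin_pi_div_three`, `tendsto_add_atTop_iff_nat`,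
`Asymptotics.isLittleO_of_tendsto`.
-/

noncomputable section

open Filter Asymptotics Finset Complex
open scoped ComplexConjugate Classical

namespace Literature.NumberTheory.GaussSums

open NumberField IsDedekindDomain
open Literature.NumberTheory.LFunctions Literature.NumberTheory.LFunctions.EisensteinGrossen
open Literature.NumberTheory.LFunctions.PlaneLattice
open Literature.NumberTheory.NumberFields Literature.NumberTheory.NumberFields.K3

namespace KummerClasses

/-! ### A. The prime number theorem for the Grössencharaktere `ν_m = ν_{1,0,m}` of `ℚ(ω)` -/

/-- The parameter `D = 1` of the family `ν_{D,r,m}` (no cubic-symbol part). [folklore] -/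
theorem one_ne_zero_K3 : (((1 : ℤ) : 𝓞 K3) : 𝓞 K3) ≠ 0 := by
  rw [Int.cast_one]; exact one_ne_zero

/-- `ν_{1,0,m}² = ν_{1,0,2m}` pointwise. [folklore] -/
theorem grossenNu_two_mul (m : ℕ) (I : Ideal (𝓞 K3)) :
    grossenNu ((1 : ℤ) : 𝓞 K3) 0 (2 * m) I = grossenNu ((1 : ℤ) : 𝓞 K3) 0 m I ^ 2 := by
  rw [grossenNu_sq, mul_zero]

/-- **The weighted prime series `Σ_𝔭 ν_m(𝔭) log N𝔭 · N𝔭^{-s}` of `ν_m = ν_{1,0,m}` (`m ≥ 1`) extends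
continuously to `Re s ≥ 1`** — `L(s, ν_m)`, `L(s, ν_{2m})` are holomorphic on `Re s > 3/4`
(`differentiableOn_grossenL`, Hecke 1920 §6 via lattice-point sector sums) and the tree's
`IdealCharPNT.exists_continuousOn_eq_tsum_logTerm` (Mertens–de la Vallée-Poussin `3-4-1` on the
line, Landau). [cite: HeckeMathZ1920, §7] -/
theorem exists_continuousOn_primeSeries {m : ℕ} (hm : 1 ≤ m) :
    ∃ r : ℂ → ℂ, ContinuousOn r {s : ℂ | 1 ≤ s.re} ∧
      ∀ s : ℂ, 1 < s.re → r s =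
        ∑' v : HeightOneSpectrum (𝓞 K3), grossenNu ((1 : ℤ) : 𝓞 K3) 0 m v.asIdeal *
          (Real.log ((Ideal.absNorm v.asIdeal : ℕ) : ℝ) : ℂ) * ((Ideal.absNorm v.asIdeal : ℕ) : ℂ) ^ (-s) := by
  have hU : IsOpen {s : ℂ | 3 / 4 < s.re} := isOpen_lt continuous_const Complex.continuous_re
  have hU1 : {s : ℂ | 1 ≤ s.re} ⊆ {s : ℂ | 3 / 4 < s.re} := fun s hs => by
    simp only [Set.mem_setOf_eq] at hs ⊢; linarith
  exact IdealCharPNT.exists_continuousOn_eq_tsum_logTerm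
    (grossenNu ((1 : ℤ) : 𝓞 K3) 0 m) (grossenNu ((1 : ℤ) : 𝓞 K3) 0 (2 * m))
    (norm_grossenNu_le _ 0 m) (grossenNu_two_mul m) hU hU1
    (differentiableOn_grossenL _ 0 m one_ne_zero_K3 hm)
    (fun s hs => grossenL_eq_LSeries _ 0 m one_ne_zero_K3 hm hs)
    (differentiableOn_grossenL _ 0 (2 * m) one_ne_zero_K3 (by omega))
    (fun s hs => grossenL_eq_LSeries _ 0 (2 * m) one_ne_zero_K3 (by omega) hs)

/-- `conj ((n : ℂ) ^ (-conj s)) = (n : ℂ) ^ (-s)` for a natural number `n`. [folklore] -/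
theorem conj_natCast_cpow_neg_conj (n : ℕ) (s : ℂ) :
    conj (((n : ℂ)) ^ (-conj s)) = (n : ℂ) ^ (-s) := by
  have harg : ((n : ℂ)).arg ≠ Real.pi := by
    rw [Complex.natCast_arg]; exact Real.pi_pos.ne
  have h := Complex.conj_cpow (n : ℂ) (n := -s) harg
  rw [Complex.conj_natCast, map_neg] at h
  rw [← h]

/-- **The conjugate series** `Σ_𝔭 conj ν_m(𝔭) log N𝔭 · N𝔭^{-s}` also extends continuously to
`Re s ≥ 1`: it is `s ↦ conj (r (conj s))`. [folklore] -/
theorem exists_continuousOn_primeSeries_conj {m : ℕ} (hm : 1 ≤ m) :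
    ∃ r : ℂ → ℂ, ContinuousOn r {s : ℂ | 1 ≤ s.re} ∧
      ∀ s : ℂ, 1 < s.re → r s =
        ∑' v : HeightOneSpectrum (𝓞 K3), conj (grossenNu ((1 : ℤ) : 𝓞 K3) 0 m v.asIdeal) *
          (Real.log ((Ideal.absNorm v.asIdeal : ℕ) : ℝ) : ℂ) * ((Ideal.absNorm v.asIdeal : ℕ) : ℂ) ^ (-s) := by
  obtain ⟨r, hr, hreq⟩ := exists_continuousOn_primeSeries hm
  refine ⟨fun s => conj (r (conj s)), ?_, fun s hs => ?_⟩
  · refine (Complex.continuous_conj.comp_continuousOn (hr.comp Complex.continuous_conj.continuousOn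
      fun s hs => ?_))
    simpa using hs
  · have hs' : 1 < (conj s).re := by simpa using hs
    dsimp only
    rw [hreq _ hs', Complex.conj_tsum]
    refine tsum_congr fun v => ?_
    rw [map_mul, map_mul, Complex.conj_ofReal, conj_natCast_cpow_neg_conj]

/-- **The prime number theorem for `ν_m`** (`m ≥ 1`): `(Σ_{N𝔭 ≤ N} ν_m(𝔭)) · log N / N → 0`
(Hecke 1920, §7, for the Grössencharaktere of `ℚ(ω)` of conductor `(3)` and frequency `m`).
[cite: HeckeMathZ1920, §7] -/
theorem tendsto_sum_grossenNu_mul_log_div {m : ℕ} (hm : 1 ≤ m) :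
    Tendsto (fun N : ℕ => (∑ n ∈ Icc 1 N, ∑ v ∈ primesOfNorm K3 n,
        grossenNu ((1 : ℤ) : 𝓞 K3) 0 m v.asIdeal) * (Real.log N : ℂ) / N) atTop (nhds 0) :=
  IdealCharPNT.tendsto_sum_mul_log_div _ (norm_grossenNu_le _ 0 m)
    (exists_continuousOn_primeSeries hm) (exists_continuousOn_primeSeries_conj hm)

/-- **The prime ideal theorem for `ℚ(ω)`** in the form `#{𝔭 : N𝔭 ≤ N} · log N / N → 1` (from the
`1 ± Re ν₁` weights of the tree's Wiener–Ikehara step). [cite: HeckeMathZ1920, §7] -/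
theorem tendsto_card_primes_mul_log_div :
    Tendsto (fun N : ℕ => (∑ n ∈ Icc 1 N, ((primesOfNorm K3 n).card : ℝ)) * Real.log N / N)
      atTop (nhds 1) := by
  have h1 := IdealCharPNT.tendsto_sum_one_add_re_mul_log_div _ (norm_grossenNu_le _ 0 1)
    (exists_continuousOn_primeSeries le_rfl) (exists_continuousOn_primeSeries_conj le_rfl)
    (w := 1) (by simp)
  have h2 := IdealCharPNT.tendsto_sum_one_add_re_mul_log_div _ (norm_grossenNu_le _ 0 1)
    (exists_continuousOn_primeSeries le_rfl) (exists_continuousOn_primeSeries_conj le_rfl)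
    (w := -1) (by simp)
  have h := (h1.add h2).mul_const (1 / 2)
  rw [show ((1 : ℝ) + 1) * (1 / 2) = 1 by norm_num] at h
  refine h.congr fun N => ?_
  have key : ∀ n, (∑ v ∈ primesOfNorm K3 n, (1 + ((1 : ℂ) * grossenNu ((1 : ℤ) : 𝓞 K3) 0 1 v.asIdeal).re)) +
      (∑ v ∈ primesOfNorm K3 n, (1 + ((-1 : ℂ) * grossenNu ((1 : ℤ) : 𝓞 K3) 0 1 v.asIdeal).re)) =
      2 * ((primesOfNorm K3 n).card : ℝ) := by
    intro n
    rw [← Finset.sum_add_distrib, Finset.card_eq_sum_ones, Nat.cast_sum, Finset.mul_sum]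
    refine Finset.sum_congr rfl fun v _ => ?_
    simp only [one_mul, neg_mul, Complex.neg_re, Nat.cast_one]
    ring
  rw [← add_div, ← add_mul, ← Finset.sum_add_distrib]
  simp_rw [key]
  rw [← Finset.mul_sum]
  ring


/-! ### B. Regrouping the primes of `ℤ[ω]` of norm `≤ N` over the rational primes -/

/-- Membership in the set of primes of norm `≤ N`. [folklore] -/
theorem mem_biUnion_primesOfNorm {N : ℕ} {v : HeightOneSpectrum (𝓞 K3)} :
    v ∈ (Icc 1 N).biUnion (primesOfNorm K3) ↔ Ideal.absNorm v.asIdeal ≤ N := by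
  rw [Finset.mem_biUnion]
  constructor
  · rintro ⟨n, hn, hv⟩
    rw [mem_primesOfNorm] at hv
    rw [hv]; exact (Finset.mem_Icc.1 hn).2
  · intro h
    refine ⟨Ideal.absNorm v.asIdeal, Finset.mem_Icc.2 ⟨?_, h⟩, by rw [mem_primesOfNorm]⟩
    exact Nat.one_le_iff_ne_zero.2 (Ideal.absNorm_eq_zero_iff.not.2 v.ne_bot)

/-- `Σ_{n ≤ N} Σ_{N𝔭 = n} f(𝔭) = Σ_{N𝔭 ≤ N} f(𝔭)`. [folklore] -/
theorem sum_Icc_sum_primesOfNorm {M : Type*} [AddCommMonoid M] (f : HeightOneSpectrum (𝓞 K3) → M)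
    (N : ℕ) : ∑ n ∈ Icc 1 N, ∑ v ∈ primesOfNorm K3 n, f v = ∑ v ∈ (Icc 1 N).biUnion (primesOfNorm K3), f v := by
  rw [Finset.sum_biUnion]
  intro n _ n' _ hnn'
  simp only [Function.onFun]
  rw [Finset.disjoint_left]
  intro v hv hv'
  rw [mem_primesOfNorm] at hv hv'
  exact hnn' (hv.symm.trans hv')

/-- **The rational prime under `𝔭` is at most `N𝔭`** (`N𝔭 ∈ {p, p²}`). [folklore] -/
theorem underPrime_le_absNorm (v : HeightOneSpectrum (𝓞 K3)) : underPrime v ≤ Ideal.absNorm v.asIdeal := by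
  set p := underPrime v with hp
  have hpp : p.Prime := underPrime_prime v
  have hmem : ((p : ℤ) : 𝓞 K3) ∈ v.asIdeal := (underPrime_eq_iff hpp).1 rfl
  have hle : Ideal.span {((p : ℤ) : 𝓞 K3)} ≤ v.asIdeal := (Ideal.span_singleton_le_iff_mem _).2 hmem
  have hdvd : Ideal.absNorm v.asIdeal ∣ p ^ 2 := by
    rw [← absNorm_span_natCast p]; exact Ideal.absNorm_dvd_absNorm_of_le hle
  obtain ⟨i, hi, heq⟩ := (Nat.dvd_prime_pow hpp).1 hdvd
  have hne : Ideal.absNorm v.asIdeal ≠ 1 := by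
    rw [Ne, Ideal.absNorm_eq_one_iff]; exact v.isPrime.ne_top
  interval_cases i
  · rw [pow_zero] at heq; exact absurd heq hne
  · rw [heq, pow_one]
  · rw [heq]; exact Nat.le_self_pow two_ne_zero p

/-- **Fibration**: `Σ_{N𝔭 ≤ N} f(𝔭) = Σ_{p ≤ N prime} Σ_{𝔭 ∣ p, N𝔭 ≤ N} f(𝔭)`. [folklore] -/
theorem sum_biUnion_eq_sum_primes {M : Type*} [AddCommMonoid M] (f : HeightOneSpectrum (𝓞 K3) → M) (N : ℕ) :
    ∑ v ∈ (Icc 1 N).biUnion (primesOfNorm K3), f v =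
      ∑ p ∈ (range (N + 1)).filter Nat.Prime,
        ∑ v ∈ (primesOver p).filter (fun v => Ideal.absNorm v.asIdeal ≤ N), f v := by
  rw [← Finset.sum_fiberwise_of_maps_to (g := underPrime) (t := (range (N + 1)).filter Nat.Prime)]
  · refine Finset.sum_congr rfl fun p hp => ?_
    have hpp : p.Prime := (Finset.mem_filter.1 hp).2
    refine Finset.sum_congr ?_ fun _ _ => rfl
    ext v
    rw [Finset.mem_filter, Finset.mem_filter, mem_biUnion_primesOfNorm, mem_primesOver hpp,
      underPrime_eq_iff hpp, and_comm]
  · intro v hv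
    rw [mem_biUnion_primesOfNorm] at hv
    rw [Finset.mem_filter, Finset.mem_range]
    exact ⟨Nat.lt_succ_of_le ((underPrime_le_absNorm v).trans hv), underPrime_prime v⟩

/-- **Non-split fibres are small**: for a prime `p ≢ 1 (mod 3)` there is at most one prime of
`ℤ[ω]` above `p`, and none of norm `≤ N` unless `p = 3` or `p² ≤ N`. [cite: IrelandRosen1990, Prop. 9.1.4] -/
theorem card_filter_primesOver_le {p : ℕ} (hp : p.Prime) (hp3 : p % 3 ≠ 1) (N : ℕ) :
    ((primesOver p).filter (fun v => Ideal.absNorm v.asIdeal ≤ N)).card ≤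
      if p = 3 ∨ p * p ≤ N then 1 else 0 := by
  have h3 : p % 3 = 0 ∨ p % 3 = 2 := by omega
  rcases h3 with h0 | h2
  · -- `p = 3`
    have hp3' : p = 3 := by
      have : 3 ∣ p := Nat.dvd_of_mod_eq_zero h0
      exact ((Nat.prime_three.eq_one_or_self_of_dvd p) |> fun _ =>
        (hp.eq_one_or_self_of_dvd 3 this).resolve_left (by norm_num)).symm
    subst hp3'
    rw [if_pos (Or.inl rfl), primesOver_three]
    exact (Finset.card_filter_le _ _).trans (Finset.card_singleton _).le
  · rw [primesOver_of_mod_three_eq_two hp h2]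
    split_ifs with h
    · exact (Finset.card_filter_le _ _).trans (Finset.card_singleton _).le
    · push Not at h
      rw [Nat.le_zero, Finset.card_eq_zero, Finset.filter_eq_empty_iff]
      intro v hv
      rw [Finset.mem_singleton] at hv
      subst hv
      rw [primeOf_asIdeal, absNorm_span_natCast, not_le, sq]
      exact h.2

/-- `#{p ≤ N : p = 3 ∨ p² ≤ N} ≤ √N + 2`. [folklore] -/
theorem card_filter_small_le (N : ℕ) :
    (((range (N + 1)).filter Nat.Prime).filter (fun p => p = 3 ∨ p * p ≤ N)).card ≤ Nat.sqrt N + 2 := by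
  calc (((range (N + 1)).filter Nat.Prime).filter (fun p => p = 3 ∨ p * p ≤ N)).card
      ≤ (insert 3 (range (Nat.sqrt N + 1))).card := by
        refine Finset.card_le_card fun p hp => ?_
        rw [Finset.mem_filter] at hp
        rw [Finset.mem_insert, Finset.mem_range]
        rcases hp.2 with h | h
        · exact Or.inl h
        · exact Or.inr (Nat.lt_succ_of_le (Nat.le_sqrt.2 h))
    _ ≤ (range (Nat.sqrt N + 1)).card + 1 := Finset.card_insert_le _ _
    _ = Nat.sqrt N + 2 := by rw [Finset.card_range]

/-- **The non-split part is `O(√N)`**: for `‖f‖ ≤ 1`,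
`‖Σ_{p ≤ N, p ≢ 1 (3)} Σ_{𝔭 ∣ p, N𝔭 ≤ N} f(𝔭)‖ ≤ √N + 2`. [folklore] -/
theorem norm_sum_nonsplit_le (f : HeightOneSpectrum (𝓞 K3) → ℂ) (hf : ∀ v, ‖f v‖ ≤ 1) (N : ℕ) :
    ‖∑ p ∈ ((range (N + 1)).filter Nat.Prime).filter (fun p => p % 3 ≠ 1),
        ∑ v ∈ (primesOver p).filter (fun v => Ideal.absNorm v.asIdeal ≤ N), f v‖ ≤ Nat.sqrt N + 2 := by
  calc ‖∑ p ∈ ((range (N + 1)).filter Nat.Prime).filter (fun p => p % 3 ≠ 1),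
        ∑ v ∈ (primesOver p).filter (fun v => Ideal.absNorm v.asIdeal ≤ N), f v‖
      ≤ ∑ p ∈ ((range (N + 1)).filter Nat.Prime).filter (fun p => p % 3 ≠ 1),
          ‖∑ v ∈ (primesOver p).filter (fun v => Ideal.absNorm v.asIdeal ≤ N), f v‖ := norm_sum_le _ _
    _ ≤ ∑ p ∈ ((range (N + 1)).filter Nat.Prime).filter (fun p => p % 3 ≠ 1),
          (((primesOver p).filter (fun v => Ideal.absNorm v.asIdeal ≤ N)).card : ℝ) := by
        refine Finset.sum_le_sum fun p _ => (norm_sum_le _ _).trans ?_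
        rw [Finset.card_eq_sum_ones, Nat.cast_sum]
        exact Finset.sum_le_sum fun v _ => by rw [Nat.cast_one]; exact hf v
    _ ≤ ∑ p ∈ ((range (N + 1)).filter Nat.Prime).filter (fun p => p % 3 ≠ 1),
          (if p = 3 ∨ p * p ≤ N then (1 : ℝ) else 0) := by
        refine Finset.sum_le_sum fun p hp => ?_
        rw [Finset.mem_filter, Finset.mem_filter] at hp
        have h := card_filter_primesOver_le hp.1.2 hp.2 N
        split_ifs at h ⊢ with hc
        · exact_mod_cast h
        · exact_mod_cast h
    _ = ((((range (N + 1)).filter Nat.Prime).filter (fun p => p % 3 ≠ 1)).filter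
          (fun p => p = 3 ∨ p * p ≤ N)).card := by
        rw [Finset.sum_boole]
    _ ≤ ((((range (N + 1)).filter Nat.Prime)).filter (fun p => p = 3 ∨ p * p ≤ N)).card := by
        exact_mod_cast Finset.card_le_card (Finset.monotone_filter_left _
          (Finset.filter_subset _ _))
    _ ≤ Nat.sqrt N + 2 := by exact_mod_cast card_filter_small_le N

/-- **The split part**: for `p ≡ 1 (mod 3)` the fibre is `{𝔭_p, 𝔭̄_p}`, both of norm `p`, so for
`p ≤ N` its contribution is `f(𝔭_p) + f(𝔭̄_p)` — given split data `vP` as produced by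
`EisensteinGrossen.exists_split_data`. [cite: IrelandRosen1990, Prop. 9.1.4] -/
theorem sum_split_fibre {M : Type*} [AddCommMonoid M] (f : HeightOneSpectrum (𝓞 K3) → M)
    {p N : ℕ} (hpN : p ≤ N) {v : HeightOneSpectrum (𝓞 K3)} (hne : v ≠ conjPrime v)
    (hover : primesOver p = {v, conjPrime v}) (hN : v.residueCard = p) :
    ∑ w ∈ (primesOver p).filter (fun w => Ideal.absNorm w.asIdeal ≤ N), f w = f v + f (conjPrime v) := by
  have hN1 : Ideal.absNorm v.asIdeal = p := hN
  have hN2 : Ideal.absNorm (conjPrime v).asIdeal = p := by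
    have h := residueCard_conjPrime v; rw [hN] at h; exact h
  rw [hover, Finset.filter_true_of_mem, Finset.sum_pair hne]
  intro w hw
  rw [Finset.mem_insert, Finset.mem_singleton] at hw
  rcases hw with rfl | rfl
  · rw [hN1]; exact hpN
  · rw [hN2]; exact hpN

/-- **Decomposition**: with split data `vP` on the primes `p ≡ 1 (mod 3)`,
`Σ_{N𝔭 ≤ N} f(𝔭) = Σ_{p ≤ N, p ≡ 1 (3)} (f(𝔭_p) + f(𝔭̄_p)) + Σ_{p ≤ N, p ≢ 1 (3)} Σ_{𝔭 ∣ p, N𝔭 ≤ N} f(𝔭)`.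
[folklore] -/
theorem sum_biUnion_eq_split_add_nonsplit {M : Type*} [AddCommMonoid M] (f : HeightOneSpectrum (𝓞 K3) → M)
    (vP : ℕ → HeightOneSpectrum (𝓞 K3))
    (hvP : ∀ p : ℕ, p.Prime → p % 3 = 1 → vP p ≠ conjPrime (vP p) ∧
      primesOver p = {vP p, conjPrime (vP p)} ∧ (vP p).residueCard = p) (N : ℕ) :
    ∑ v ∈ (Icc 1 N).biUnion (primesOfNorm K3), f v =
      ∑ p ∈ (range (N + 1)).filter (fun p => p.Prime ∧ p % 3 = 1), (f (vP p) + f (conjPrime (vP p))) +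
      ∑ p ∈ ((range (N + 1)).filter Nat.Prime).filter (fun p => p % 3 ≠ 1),
        ∑ v ∈ (primesOver p).filter (fun v => Ideal.absNorm v.asIdeal ≤ N), f v := by
  rw [sum_biUnion_eq_sum_primes, ← Finset.sum_filter_add_sum_filter_not _ (fun p => p % 3 = 1),
    Finset.filter_filter]
  congr 1
  refine Finset.sum_congr rfl fun p hp => ?_
  rw [Finset.mem_filter, Finset.mem_range] at hp
  obtain ⟨hne, hover, hN⟩ := hvP p hp.2.1 hp.2.2
  exact sum_split_fibre f (Nat.le_of_lt_succ hp.1) hne hover hN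

/-! ### B'. The asymptotic consequences: split primes carry everything -/

/-- `(√N + 2) · log N / N → 0`. [folklore] -/
theorem tendsto_sqrt_add_two_mul_log_div :
    Tendsto (fun N : ℕ => ((Nat.sqrt N : ℝ) + 2) * Real.log N / N) atTop (nhds 0) := by
  -- `log x / x^{1/2} → 0` and `log x / x → 0` along the naturals
  have h1 : Tendsto (fun N : ℕ => Real.log N / (N : ℝ) ^ (1 / 2 : ℝ)) atTop (nhds 0) :=
    ((isLittleO_log_rpow_atTop (by norm_num : (0 : ℝ) < 1 / 2)).comp_tendsto
      tendsto_natCast_atTop_atTop).tendsto_div_nhds_zero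
  have h2 : Tendsto (fun N : ℕ => Real.log N / (N : ℝ)) atTop (nhds 0) := by
    have := ((isLittleO_log_rpow_atTop (by norm_num : (0 : ℝ) < 1)).comp_tendsto
      tendsto_natCast_atTop_atTop).tendsto_div_nhds_zero
    simpa using this
  have h3 : Tendsto (fun N : ℕ => Real.log N / (N : ℝ) ^ (1 / 2 : ℝ) + 2 * (Real.log N / N)) atTop (nhds 0) := by
    simpa using h1.add (h2.const_mul 2)
  refine tendsto_of_tendsto_of_tendsto_of_le_of_le' tendsto_const_nhds h3 ?_ ?_
  · filter_upwards [eventually_ge_atTop 1] with N hN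
    have hlog : 0 ≤ Real.log N := Real.log_nonneg (by exact_mod_cast hN)
    positivity
  · filter_upwards [eventually_ge_atTop 1] with N hN
    have hN0 : (0 : ℝ) < N := by exact_mod_cast hN
    have hlog : 0 ≤ Real.log N := Real.log_nonneg (by exact_mod_cast hN)
    have hs : (Nat.sqrt N : ℝ) ≤ (N : ℝ) ^ (1 / 2 : ℝ) := by
      rw [← Real.sqrt_eq_rpow, Real.le_sqrt (by positivity) hN0.le]
      exact_mod_cast Nat.sqrt_le' N
    have hhalf : (N : ℝ) ^ (1 / 2 : ℝ) * (N : ℝ) ^ (1 / 2 : ℝ) = N := by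
      rw [← Real.rpow_add hN0]; norm_num
    have hr0 : 0 < (N : ℝ) ^ (1 / 2 : ℝ) := Real.rpow_pos_of_pos hN0 _
    rw [show (2 : ℝ) * (Real.log N / N) = 2 * Real.log N / N by ring,
      div_add_div _ _ hr0.ne' hN0.ne', div_le_div_iff₀ hN0 (mul_pos hr0 hN0)]
    have hLrN : 0 ≤ Real.log N * (N : ℝ) ^ (1 / 2 : ℝ) * N := mul_nonneg (mul_nonneg hlog hr0.le) hN0.le
    calc ((Nat.sqrt N : ℝ) + 2) * Real.log N * ((N : ℝ) ^ (1 / 2 : ℝ) * N)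
        = (Nat.sqrt N : ℝ) * (Real.log N * (N : ℝ) ^ (1 / 2 : ℝ) * N) +
            2 * (Real.log N * (N : ℝ) ^ (1 / 2 : ℝ) * N) := by ring
      _ ≤ (N : ℝ) ^ (1 / 2 : ℝ) * (Real.log N * (N : ℝ) ^ (1 / 2 : ℝ) * N) +
            2 * (Real.log N * (N : ℝ) ^ (1 / 2 : ℝ) * N) :=
          by linarith [mul_le_mul_of_nonneg_right hs hLrN]
      _ = (Real.log N * N + (N : ℝ) ^ (1 / 2 : ℝ) * (2 * Real.log N)) * N := by
          linear_combination (Real.log N * N) * hhalf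

/-- Notation-free form of the split sum of a function `f` over the chosen primes `𝔭_p`. For
`‖f‖ ≤ 1`: `‖Σ_{N𝔭 ≤ N} f(𝔭) − Σ_{p ≤ N, p ≡ 1 (3)} (f(𝔭_p) + f(𝔭̄_p))‖ ≤ √N + 2`. [folklore] -/
theorem norm_sum_biUnion_sub_split_le (f : HeightOneSpectrum (𝓞 K3) → ℂ) (hf : ∀ v, ‖f v‖ ≤ 1)
    (vP : ℕ → HeightOneSpectrum (𝓞 K3))
    (hvP : ∀ p : ℕ, p.Prime → p % 3 = 1 → vP p ≠ conjPrime (vP p) ∧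
      primesOver p = {vP p, conjPrime (vP p)} ∧ (vP p).residueCard = p) (N : ℕ) :
    ‖∑ v ∈ (Icc 1 N).biUnion (primesOfNorm K3), f v -
      ∑ p ∈ (range (N + 1)).filter (fun p => p.Prime ∧ p % 3 = 1), (f (vP p) + f (conjPrime (vP p)))‖ ≤
      Nat.sqrt N + 2 := by
  rw [sum_biUnion_eq_split_add_nonsplit f vP hvP N, add_sub_cancel_left]
  exact norm_sum_nonsplit_le f hf N

/-- **Split primes, character sums**: `(Σ_{p ≤ N, p ≡ 1 (3)} (ν_m(𝔭_p) + ν_m(𝔭̄_p))) · log N / N → 0`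
for `m ≥ 1`. [cite: HeckeMathZ1920, §7] -/
theorem tendsto_sum_split_grossenNu_mul_log_div {m : ℕ} (hm : 1 ≤ m)
    (vP : ℕ → HeightOneSpectrum (𝓞 K3))
    (hvP : ∀ p : ℕ, p.Prime → p % 3 = 1 → vP p ≠ conjPrime (vP p) ∧
      primesOver p = {vP p, conjPrime (vP p)} ∧ (vP p).residueCard = p) :
    Tendsto (fun N : ℕ => (∑ p ∈ (range (N + 1)).filter (fun p => p.Prime ∧ p % 3 = 1),
        (grossenNu ((1 : ℤ) : 𝓞 K3) 0 m (vP p).asIdeal +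
          grossenNu ((1 : ℤ) : 𝓞 K3) 0 m (conjPrime (vP p)).asIdeal)) * (Real.log N : ℂ) / N)
      atTop (nhds 0) := by
  set f : HeightOneSpectrum (𝓞 K3) → ℂ := fun v => grossenNu ((1 : ℤ) : 𝓞 K3) 0 m v.asIdeal with hf
  have hA := tendsto_sum_grossenNu_mul_log_div hm
  -- the difference tends to `0`
  have hdiff : Tendsto (fun N : ℕ => (∑ v ∈ (Icc 1 N).biUnion (primesOfNorm K3), f v -
      ∑ p ∈ (range (N + 1)).filter (fun p => p.Prime ∧ p % 3 = 1), (f (vP p) + f (conjPrime (vP p)))) *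
        (Real.log N : ℂ) / N) atTop (nhds 0) := by
    rw [tendsto_zero_iff_norm_tendsto_zero]
    refine tendsto_of_tendsto_of_tendsto_of_le_of_le' tendsto_const_nhds tendsto_sqrt_add_two_mul_log_div
      (Eventually.of_forall fun N => norm_nonneg _) ?_
    filter_upwards [eventually_ge_atTop 1] with N hN
    have hlog : 0 ≤ Real.log N := Real.log_nonneg (by exact_mod_cast hN)
    have hN0 : (0 : ℝ) < N := by exact_mod_cast hN
    rw [norm_div, norm_mul, Complex.norm_natCast, Complex.norm_real, Real.norm_of_nonneg hlog]
    have h := norm_sum_biUnion_sub_split_le f (fun v => norm_grossenNu_le _ 0 m _) vP hvP N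
    gcongr
  have hA' : Tendsto (fun N : ℕ => (∑ v ∈ (Icc 1 N).biUnion (primesOfNorm K3), f v) * (Real.log N : ℂ) / N)
      atTop (nhds 0) := by
    refine hA.congr fun N => ?_
    rw [sum_Icc_sum_primesOfNorm]
  have h := hA'.sub hdiff
  rw [sub_zero] at h
  refine h.congr fun N => ?_
  simp only [hf]
  ring

/-- **Split primes, counting** (the prime number theorem for `p ≡ 1 (mod 3)` through `ℚ(ω)`):
`#{p ≤ N : p ≡ 1 (3)} · log N / N → 1/2`. [cite: HeckeMathZ1920, §7] -/
theorem tendsto_card_split_mul_log_div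
    (vP : ℕ → HeightOneSpectrum (𝓞 K3))
    (hvP : ∀ p : ℕ, p.Prime → p % 3 = 1 → vP p ≠ conjPrime (vP p) ∧
      primesOver p = {vP p, conjPrime (vP p)} ∧ (vP p).residueCard = p) :
    Tendsto (fun N : ℕ => (((range (N + 1)).filter (fun p => p.Prime ∧ p % 3 = 1)).card : ℝ) *
      Real.log N / N) atTop (nhds (1 / 2)) := by
  have hA := tendsto_card_primes_mul_log_div
  set f : HeightOneSpectrum (𝓞 K3) → ℂ := fun _ => 1 with hf
  -- the card as the `f = 1` sum, and the split sum as twice the count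
  have hT : ∀ N : ℕ, (∑ n ∈ Icc 1 N, ((primesOfNorm K3 n).card : ℝ)) =
      (∑ v ∈ (Icc 1 N).biUnion (primesOfNorm K3), f v).re := by
    intro N
    rw [← sum_Icc_sum_primesOfNorm, Complex.re_sum]
    refine Finset.sum_congr rfl fun n _ => ?_
    rw [Complex.re_sum, Finset.card_eq_sum_ones, Nat.cast_sum]
    simp [hf]
  have hS : ∀ N : ℕ, (∑ p ∈ (range (N + 1)).filter (fun p => p.Prime ∧ p % 3 = 1),
      (f (vP p) + f (conjPrime (vP p)))).re =
      2 * (((range (N + 1)).filter (fun p => p.Prime ∧ p % 3 = 1)).card : ℝ) := by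
    intro N
    rw [Complex.re_sum, Finset.card_eq_sum_ones, Nat.cast_sum, Finset.mul_sum]
    refine Finset.sum_congr rfl fun p _ => ?_
    simp [hf]; norm_num
  -- the difference is `O(√N)`
  have hdiff : Tendsto (fun N : ℕ => ((∑ v ∈ (Icc 1 N).biUnion (primesOfNorm K3), f v).re -
      (∑ p ∈ (range (N + 1)).filter (fun p => p.Prime ∧ p % 3 = 1), (f (vP p) + f (conjPrime (vP p)))).re) *
        Real.log N / N) atTop (nhds 0) := by
    rw [tendsto_zero_iff_norm_tendsto_zero]
    refine tendsto_of_tendsto_of_tendsto_of_le_of_le' tendsto_const_nhds tendsto_sqrt_add_two_mul_log_div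
      (Eventually.of_forall fun N => norm_nonneg _) ?_
    filter_upwards [eventually_ge_atTop 1] with N hN
    have hlog : 0 ≤ Real.log N := Real.log_nonneg (by exact_mod_cast hN)
    have hN0 : (0 : ℝ) < N := by exact_mod_cast hN
    rw [norm_div, norm_mul, Real.norm_natCast, Real.norm_of_nonneg hlog, ← Complex.sub_re]
    have h := norm_sum_biUnion_sub_split_le f (fun v => by simp [hf]) vP hvP N
    have h' := (Complex.abs_re_le_norm _).trans h
    rw [Real.norm_eq_abs]
    gcongr
  have hA' : Tendsto (fun N : ℕ => (∑ v ∈ (Icc 1 N).biUnion (primesOfNorm K3), f v).re * Real.log N / N)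
      atTop (nhds 1) := hA.congr fun N => by rw [hT]
  have h := ((hA'.sub hdiff).mul_const (1 / 2))
  rw [sub_zero, one_mul] at h
  refine h.congr fun N => ?_
  rw [← sub_div, ← sub_mul, sub_sub_cancel, hS]
  ring

/-- **Split primes, real parts**: `(Σ_{p ≤ N, p ≡ 1 (3)} Re ν_m(𝔭_p)) · log N / N → 0` (`m ≥ 1`),
since `ν_m(𝔭̄) = conj ν_m(𝔭)`. [cite: HeckeMathZ1920, §7] -/
theorem tendsto_sum_re_grossenNu_mul_log_div {m : ℕ} (hm : 1 ≤ m)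
    (vP : ℕ → HeightOneSpectrum (𝓞 K3))
    (hvP : ∀ p : ℕ, p.Prime → p % 3 = 1 → vP p ≠ conjPrime (vP p) ∧
      primesOver p = {vP p, conjPrime (vP p)} ∧ (vP p).residueCard = p) :
    Tendsto (fun N : ℕ => (∑ p ∈ (range (N + 1)).filter (fun p => p.Prime ∧ p % 3 = 1),
        (grossenNu ((1 : ℤ) : 𝓞 K3) 0 m (vP p).asIdeal).re) * Real.log N / N) atTop (nhds 0) := by
  have h := (Complex.continuous_re.tendsto 0).comp (tendsto_sum_split_grossenNu_mul_log_div hm vP hvP)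
  rw [Complex.zero_re] at h
  have h2 := h.mul_const (1 / 2)
  rw [zero_mul] at h2
  refine h2.congr fun N => ?_
  rw [Function.comp_apply]
  have e1 : ∀ p : ℕ, grossenNu ((1 : ℤ) : 𝓞 K3) 0 m (vP p).asIdeal +
      grossenNu ((1 : ℤ) : 𝓞 K3) 0 m (conjPrime (vP p)).asIdeal =
        (((2 * (grossenNu ((1 : ℤ) : 𝓞 K3) 0 m (vP p).asIdeal).re : ℝ)) : ℂ) := fun p => by
    rw [grossenNu_conjPrime, Complex.add_conj, Complex.ofReal_mul, Complex.ofReal_ofNat]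
  have e : ((∑ p ∈ (range (N + 1)).filter (fun p => p.Prime ∧ p % 3 = 1),
      (grossenNu ((1 : ℤ) : 𝓞 K3) 0 m (vP p).asIdeal + grossenNu ((1 : ℤ) : 𝓞 K3) 0 m (conjPrime (vP p)).asIdeal)) *
        (Real.log N : ℂ) / N) = (((2 * ∑ p ∈ (range (N + 1)).filter (fun p => p.Prime ∧ p % 3 = 1),
          (grossenNu ((1 : ℤ) : 𝓞 K3) 0 m (vP p).asIdeal).re) * Real.log N / N : ℝ) : ℂ) := by
    simp_rw [e1]
    push_cast
    rw [Finset.mul_sum]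
  rw [e, Complex.ofReal_re]
  ring

/-- **Hecke's equidistribution theorem for the Eisenstein primes, normalised by the count**:
`(Σ_{p ≤ N, p ≡ 1 (3)} Re ν_m(𝔭_p)) / #{p ≤ N : p ≡ 1 (3)} → 0` for every `m ≥ 1`.
[cite: HeckeMathZ1920, §7] -/
theorem tendsto_sum_re_grossenNu_div_card {m : ℕ} (hm : 1 ≤ m)
    (vP : ℕ → HeightOneSpectrum (𝓞 K3))
    (hvP : ∀ p : ℕ, p.Prime → p % 3 = 1 → vP p ≠ conjPrime (vP p) ∧
      primesOver p = {vP p, conjPrime (vP p)} ∧ (vP p).residueCard = p) :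
    Tendsto (fun N : ℕ => (∑ p ∈ (range (N + 1)).filter (fun p => p.Prime ∧ p % 3 = 1),
        (grossenNu ((1 : ℤ) : 𝓞 K3) 0 m (vP p).asIdeal).re) /
        (((range (N + 1)).filter (fun p => p.Prime ∧ p % 3 = 1)).card : ℝ)) atTop (nhds 0) := by
  have hnum := tendsto_sum_re_grossenNu_mul_log_div hm vP hvP
  have hden := tendsto_card_split_mul_log_div vP hvP
  have h := hnum.div hden (by norm_num)
  rw [zero_div] at h
  refine h.congr' ?_
  filter_upwards [eventually_ge_atTop 2] with N hN
  have hlog : 0 < Real.log N := Real.log_pos (by exact_mod_cast hN)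
  have hN0 : (0 : ℝ) < N := by exact_mod_cast (by omega : 0 < N)
  simp only [Pi.div_apply]
  set a : ℝ := ∑ p ∈ (range (N + 1)).filter (fun p => p.Prime ∧ p % 3 = 1),
    (grossenNu ((1 : ℤ) : 𝓞 K3) 0 m (vP p).asIdeal).re
  set b : ℝ := (((range (N + 1)).filter (fun p => p.Prime ∧ p % 3 = 1)).card : ℝ)
  rw [mul_div_assoc (a := b), mul_div_assoc (a := a), mul_div_mul_right _ _ (div_pos hlog hN0).ne']

/-! ### C. The value of `ν_m` at a split prime is `(−J_p/√p)^m`: the link to Kummer's sum -/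

/-- The two normalisations of `ω` agree: `EisensteinGrossen.w = ⟨−1/2, √3/2⟩ = e^{2πi/3} = omega`.
[folklore] -/
theorem w_eq_omega : EisensteinGrossen.w = omega := by
  have hz : (2 * Real.pi * Complex.I / 3 : ℂ) = ((2 * Real.pi / 3 : ℝ) : ℂ) * Complex.I := by
    push_cast; ring
  have hc : Real.cos (2 * Real.pi / 3) = -1 / 2 := by
    rw [show 2 * Real.pi / 3 = Real.pi - Real.pi / 3 by ring, Real.cos_pi_sub, Real.cos_pi_div_three]
    norm_num
  have hs : Real.sin (2 * Real.pi / 3) = Real.sqrt 3 / 2 := by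
    rw [show 2 * Real.pi / 3 = Real.pi - Real.pi / 3 by ring, Real.sin_pi_sub, Real.sin_pi_div_three]
  unfold omega
  rw [hz, Complex.exp_mul_I, ← Complex.ofReal_cos, ← Complex.ofReal_sin, hc, hs]
  apply Complex.ext
  · simp [EisensteinGrossen.w_re]
  · simp [EisensteinGrossen.w_im]

/-- `(p J)/|p J| = J/|J|` for `p > 0`. [folklore] -/
theorem natCast_mul_div_norm {p : ℕ} (hp : p ≠ 0) (J : ℂ) :
    (p : ℂ) * J / (‖(p : ℂ) * J‖ : ℂ) = J / (‖J‖ : ℂ) := by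
  rw [norm_mul, Complex.norm_natCast]
  push_cast
  rw [mul_div_mul_left _ _ (by exact_mod_cast hp : (p : ℂ) ≠ 0)]

/-- **The identification.** Let `p ≡ 1 (mod 3)`, `r` a primitive root, `J = J(χ_{p,r}, χ_{p,r})`
(`= a + bω`, `a ≡ −1`, `b ≡ 0 (mod 3)`, `|J|² = p`, Ireland–Rosen Prop. 8.3.4). Then `−J`, read in
`ℤ[ω]`, is the PRIMARY generator of one of the two primes `𝔭, 𝔭̄` above `p`, so
`ν_m(𝔭) ∈ {(−J/√p)^m, conj (−J/√p)^m}` and, with `g_{p,r}³ = pJ` (Prop. 8.3.3),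
`Re ν_m(𝔭) = (−1)^m cos(m · arg g_{p,r}³)`. [cite: IrelandRosen1990, Ch. 9 §12 Lemma 1] -/
theorem re_grossenNu_eq_cos {p : ℕ} [hp : Fact p.Prime] (h3 : p % 3 = 1) {r : ℕ}
    (hr : IsPrimitiveRoot (r : ZMod p) (p - 1)) {v : HeightOneSpectrum (𝓞 K3)}
    (hover : primesOver p = {v, conjPrime v}) (m : ℕ) :
    (grossenNu ((1 : ℤ) : 𝓞 K3) 0 m v.asIdeal).re =
      (-1) ^ m * Real.cos (m * Complex.arg (cubicGaussSum p r ^ 3)) := by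
  obtain ⟨a, b, hJ, ha, hb⟩ := jacobiSum_cubicMulChar_primary h3 hr
  set J := jacobiSum (cubicMulChar h3 hr) (cubicMulChar h3 hr) with hJdef
  have hJn : Complex.normSq J = p := normSq_jacobiSum_cubicMulChar h3 hr
  have hnorm : (-a) ^ 2 - (-a) * (-b) + (-b) ^ 2 = (p : ℤ) := by
    have h1 := normSq_int_add_int_mul_omega a b
    rw [← hJ, hJn] at h1
    have h2 : (p : ℤ) = a ^ 2 - a * b + b ^ 2 := by exact_mod_cast h1
    linarith [h2]
  have hx : Prime (mkInt (-a) (-b)) := prime_mkInt_of_norm_eq_prime hp.out hnorm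
  -- `(x)` is one of the primes above `p`
  have hmem : primeOf hx ∈ primesOver p := by
    rw [mem_primesOver hp.out, primeOf_asIdeal]
    have : ((p : ℤ) : 𝓞 K3) ∈ Ideal.span {mkInt (-a) (-b)} * Ideal.span {mkInt (-a - -b) (- -b)} := by
      rw [← span_natCast_eq_mul_conj hnorm]; exact Ideal.mem_span_singleton_self _
    exact Ideal.mul_le_right this
  -- `x ≡ 1 (mod 3)`
  have hx1 : mkInt (-a) (-b) - 1 ∈ three := by
    have e : mkInt (-a) (-b) - 1 = mkInt (-a - 1) (-b) := by
      have h1 : (1 : 𝓞 K3) = mkInt 1 0 := by rw [mkInt_intCast]; push_cast; rfl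
      rw [h1, sub_eq_add_neg, neg_mkInt, mkInt_add]
      congr 1
      ring
    rw [e, Ideal.mem_span_singleton]
    have h3c : (3 : 𝓞 K3) = ((3 : ℤ) : 𝓞 K3) := by push_cast; rfl
    rw [h3c, intCast_dvd_mkInt_iff]
    refine ⟨?_, ?_⟩
    · have h := ha.dvd
      rwa [show (-1 : ℤ) - a = -a - 1 by ring] at h
    · have h := hb.dvd
      rwa [zero_sub] at h
  -- the value at `(x)`
  have hadm : Adm ((1 : ℤ) : 𝓞 K3) (Ideal.span {mkInt (-a) (-b)}) := by
    refine ⟨by rw [Ne, Ideal.span_singleton_eq_bot]; exact hx.ne_zero, ?_⟩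
    rw [Int.cast_one, mul_one]
    exact isCoprime_three_of_sub_one_mem hx1
  have hval : grossenNu ((1 : ℤ) : 𝓞 K3) 0 m (Ideal.span {mkInt (-a) (-b)}) = sectorWeight m (-J) := by
    rw [grossenNu_span_of_primary _ 0 m hx1 hadm, pow_zero, one_mul, embC_mkInt, w_eq_omega, hJ]
    push_cast
    ring_nf
  -- `v = (x)` or `v̄ = (x)`; the real parts agree in both cases
  have hv : (grossenNu ((1 : ℤ) : 𝓞 K3) 0 m v.asIdeal).re = (sectorWeight m (-J)).re := by
    rw [hover, Finset.mem_insert, Finset.mem_singleton] at hmem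
    rcases hmem with h | h
    · rw [← h, primeOf_asIdeal, hval]
    · have h2 := grossenNu_conjPrime 1 0 m v
      rw [← h, primeOf_asIdeal, hval] at h2
      rw [h2, Complex.conj_re]
  rw [hv]
  -- `(sectorWeight m (−J)).re = (−1)^m cos(m · arg(pJ))`
  have hJ0 : J ≠ 0 := by
    intro h0
    have : (p : ℝ) = 0 := by rw [← hJn, h0, map_zero]
    exact hp.out.ne_zero (by exact_mod_cast this)
  have hg : cubicGaussSum p r ^ 3 = p * J := cubicGaussSum_pow_three h3 hr
  have hg0 : cubicGaussSum p r ^ 3 ≠ 0 := by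
    rw [hg]; exact mul_ne_zero (by exact_mod_cast hp.out.ne_zero) hJ0
  rw [cos_nat_mul_arg hg0 m, hg, natCast_mul_div_norm hp.out.ne_zero]
  unfold sectorWeight
  rw [norm_neg, neg_div, neg_pow, show ((-1 : ℂ)) ^ m = (((-1 : ℝ) ^ m : ℝ) : ℂ) by push_cast; rfl,
    Complex.re_ofReal_mul]

/-! ### D. Assembly: the Hecke half of the Weyl criterion, and the reduction to HBP's estimate -/

/-- **Hecke (1920) for the Eisenstein primes, in Kummer-sum form**: for every `m ≥ 1` and every
choice of primitive roots `r_p`,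
`(Σ_{p ≤ N, p ≡ 1 (3)} cos(m · arg g_{p,r_p}³)) / #{p ≤ N : p ≡ 1 (3)} → 0` — the angles of
`g_p³ = p J_p`, i.e. of the primary primes `π ≡ 1 (mod 3)` of `ℤ[ω]`, are equidistributed.
[cite: HeckeMathZ1920, §7] -/
theorem tendsto_sum_cos_arg_cube_div_card {m : ℕ} (hm : 1 ≤ m) (r : ℕ → ℕ)
    (hr : ∀ p : ℕ, p.Prime → p % 3 = 1 → IsPrimitiveRoot (r p : ZMod p) (p - 1)) :
    Tendsto (fun N : ℕ => (∑ p ∈ (range (N + 1)).filter (fun p => p.Prime ∧ p % 3 = 1),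
        Real.cos (m * Complex.arg (cubicGaussSum p (r p) ^ 3))) /
        (((range (N + 1)).filter (fun p => p.Prime ∧ p % 3 = 1)).card : ℝ)) atTop (nhds 0) := by
  -- choose split data
  have hsd : ∀ p : ℕ, ∃ v : HeightOneSpectrum (𝓞 K3), p.Prime → p % 3 = 1 →
      (v ≠ conjPrime v ∧ primesOver p = {v, conjPrime v} ∧ v.residueCard = p) := by
    intro p
    by_cases hp : p.Prime ∧ p % 3 = 1
    · obtain ⟨v, ϖ, hne, hover, -, hN, -⟩ := exists_split_data hp.1 hp.2
      exact ⟨v, fun _ _ => ⟨hne, hover, hN⟩⟩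
    · exact ⟨primeOf prime_lamInt, fun h1 h2 => absurd ⟨h1, h2⟩ hp⟩
  choose vP hvP using hsd
  have h := (tendsto_sum_re_grossenNu_div_card hm vP hvP).const_mul ((-1 : ℝ) ^ m)
  rw [mul_zero] at h
  refine h.congr fun N => ?_
  rw [← mul_div_assoc, Finset.mul_sum]
  congr 1
  refine Finset.sum_congr rfl fun p hp => ?_
  rw [Finset.mem_filter] at hp
  haveI : Fact p.Prime := ⟨hp.2.1⟩
  rw [re_grossenNu_eq_cos hp.2.2 (hr p hp.2.1 hp.2.2) (hvP p hp.2.1 hp.2.2).2.1 m, ← mul_assoc,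
    ← mul_pow, neg_one_mul, neg_neg, one_pow, one_mul]

/-- **The Hecke hypothesis `hHecke` of `HeathBrownPatterson1979_kummerClasses_of_hecke_of_heathBrownPatterson`
holds**: `Σ_{p < B, p ≡ 1 (3)} cos(m · arg g_p³) = o(#{p < B : p ≡ 1 (3)})` for `m ≠ 0`.
[cite: HeckeMathZ1920, §7] -/
theorem isLittleO_sum_cos_arg_cube {m : ℕ} (hm : m ≠ 0) (r : ℕ → ℕ)
    (hr : ∀ p : ℕ, p.Prime → p % 3 = 1 → IsPrimitiveRoot (r p : ZMod p) (p - 1)) :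
    (fun B => ∑ p ∈ (Finset.range B).filter (fun p => p.Prime ∧ p % 3 = 1),
        Real.cos (m * Complex.arg (cubicGaussSum p (r p) ^ 3))) =o[atTop]
      fun B => (kummerPrimeCount B : ℝ) := by
  have h := tendsto_sum_cos_arg_cube_div_card (Nat.one_le_iff_ne_zero.2 hm) r hr
  have h' : Tendsto (fun B : ℕ => (∑ p ∈ (Finset.range B).filter (fun p => p.Prime ∧ p % 3 = 1),
      Real.cos (m * Complex.arg (cubicGaussSum p (r p) ^ 3))) / (kummerPrimeCount B : ℝ)) atTop (nhds 0) :=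
    (tendsto_add_atTop_iff_nat 1).1 h
  refine isLittleO_of_tendsto (fun B hB => ?_) h'
  have h0 : (Finset.range B).filter (fun p => p.Prime ∧ p % 3 = 1) = ∅ := by
    rw [← Finset.card_eq_zero]; exact_mod_cast hB
  rw [h0, Finset.sum_empty]

end KummerClasses

/-- **Reduction of the fact to the Heath-Brown–Patterson estimate alone.** After this file the
Hecke half (`3 ∣ k`: Hecke 1920, equidistribution of the primary primes of `ℤ[ω]` in sectors, via
the Grössencharaktere `ν_m = (π/|π|)^m` and the prime ideal theorem with pole-free continuation)
is a theorem; what remains of the Weyl criterion is exactly estimate (3) of Heath-Brown–Patterson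
for the orders `k` prime to `3` — the uniform distribution of `arg g̃(π)` itself (cubic
metaplectic theta functions, Kubota–Patterson). [cite: HeathBrownPatterson1979, Theorem 1] -/
theorem HeathBrownPatterson1979_kummerClasses_of_heathBrownPatterson (r : ℕ → ℕ)
    (hr : ∀ p : ℕ, p.Prime → p % 3 = 1 → IsPrimitiveRoot (r p : ZMod p) (p - 1))
    (hHBP : ∀ k : ℕ, ¬ 3 ∣ k →
      (fun B => ∑ p ∈ (Finset.range B).filter (fun p => p.Prime ∧ p % 3 = 1),
        Real.cos (k * Complex.arg (cubicGaussSum p (r p)))) =o[atTop]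
      fun B => (kummerPrimeCount B : ℝ)) :
    HeathBrownPatterson1979_kummerClasses :=
  HeathBrownPatterson1979_kummerClasses_of_hecke_of_heathBrownPatterson r hr
    (fun _ hm => KummerClasses.isLittleO_sum_cos_arg_cube hm r hr) hHBP

/-- **The prime number theorem for `p ≡ 1 (mod 3)` through `ℚ(ω)`**:
`#{p ≤ N : p prime, p ≡ 1 (3)} · log N / N → 1/2` (split primes are half of all primes; obtained
here from the prime ideal theorem of `ℚ(ω)` with the `1 ± Re ν₁` weights and the splitting law,
not from `L(s, χ₃)`; `kummerPrimeCount (N + 1) = #{p ≤ N : p ≡ 1 (3)}`). [cite: HeckeMathZ1920, §7] -/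
theorem tendsto_kummerPrimeCount_succ_mul_log_div :
    Tendsto (fun N : ℕ => (kummerPrimeCount (N + 1) : ℝ) * Real.log N / N) atTop (nhds (1 / 2)) := by
  have hsd : ∀ p : ℕ, ∃ v : HeightOneSpectrum (𝓞 K3), p.Prime → p % 3 = 1 →
      (v ≠ conjPrime v ∧ primesOver p = {v, conjPrime v} ∧ v.residueCard = p) := by
    intro p
    by_cases hp : p.Prime ∧ p % 3 = 1
    · obtain ⟨v, ϖ, hne, hover, -, hN, -⟩ := exists_split_data hp.1 hp.2
      exact ⟨v, fun _ _ => ⟨hne, hover, hN⟩⟩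
    · exact ⟨primeOf prime_lamInt, fun h1 h2 => absurd ⟨h1, h2⟩ hp⟩
  choose vP hvP using hsd
  exact KummerClasses.tendsto_card_split_mul_log_div vP hvP

end Literature.NumberTheory.GaussSums
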